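import Summits.QuantumFields.YangMills.Theorems.UnitScaleTiltProp7QTwSScalarSectorRegPr
import Summits.QuantumFields.YangMills.Theorems.UnitScaleTiltProp7FrameResponseCombSU2T3
import Summits.QuantumFields.YangMills.Theorems.UnitScaleTiltProp7SymFrameCovDefs
import Summits.QuantumFields.YangMills.Theorems.UnitScaleTiltProp8ChartCovariance
import Literature.MathematicalPhysics.QuantumFieldTheory.Balaban1983to89.B8Prop7AdmittedFamily
import Literature.MathematicalPhysics.QuantumFieldTheory.Balaban1983to89.B7Eq99Concrete
import HarnessLib

/-!
# Route `UnitScaleTilt`, crux K1 child «MinimiserStabilityRegPr» (stmt-QuantumFields-19200), stub `stub_existenceMinimalOrbit` (EX), lane II (B4★)∕(QB) «⊕ central» summand —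
# **THE UNITARY SCALAR PROBE `e^{itr}` OF THE COMB CHART: ITS TOWERS ARE SMALL FOR SMALL `t`** (the `∃ δ` clause of ✓`Prop7QTwCentralSector.QTw_smulI_one_eq_QTw_one`, discharged):
# for a REAL bond field `r` on `T^{(K)}` and real `t` with `|t| < δ(r, L, K − n)` — (i) every loop variable (42) of every `ℤ³` iterate `\overline{(e^{itr})♯}ʲ`, `j < K − n`, of the based
# pullback is within `1∕8` of `1` ([Balaban1985Averaging] Prop. 2 at `𝔸 = ℂ`, `G = U(1)`); (ii) the flat frame quotients `v_j(Lw)⁻¹·\overline{φ♯}ʲ(Γ_{Lw,x})·v_j(x)` are within `1` of `1`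
# (lit `B8Prop7AdmittedFamily` (162)–(163) at `𝔸 = ℂ`, `U₀ = 1`); (iii) every (0.4) loop variable of the plain TORUS tower `Ūʲ(e^{itr})` is within `1∕8` of `1` (✓`scalarTower_small_T3` for the
# double-bar tower + gauge invariance of abelian loop variables).  Every window is the FIXED number `ε_s := (10⁷L³)⁻¹` fed through ✓`windows_of_ten7`∕`tower_windows_of_ten7`.

Cell `ym3-torus`, width seat `ym3-torus-px10` (gen 5).  `--supports stmt-QuantumFields-19200 --as helper`; THEOREMS ONLY (0 `def`, 0 `sorry`); count-neutral; nothing here claims the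
stub, the crux, d = 4 or the mass gap — YM₃ on T³ is a ladder rung (R3), not the Clay problem.

WHY (px19 g6 LOCATE v2 §3 exit (c-i); px10 g5 LOCATE).  The comb chart `QTw U₀` on the centre is computed by differentiating `log U̿^{tw}((t·ir)·1)` along REAL `t` (✓`Prop7QTwCentralSector`);
the principal-branch windows of that identity are discharged here for the UNITARY scalar field `e^{itr}` (so that lit's unitary-class bounds apply verbatim at `𝔸 = ℂ`); the extension to every
complex scalar field is ℂ-linearity (✓`QTw_smul_one_eq_QTw_one_of_imaginary`).  The sibling `…Prop7QTwCentralSectorRegPr` supplies the background clauses at `RegPr` and assembles.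

WHAT IS PROVED:
* §1 (generic `ℤᵈ`, any complete normed ℂ-algebra with `‖1‖ = 1`) `norm_plaq_sub_one_le_of_bonds`, ★`loops_le_eighth_of_pdev` (Prop. 2 ∘ p. 25: for a `G`-valued `V` with
  `sup_p|V(∂p) − 1| < α₀L^{−2k}` in Prop. 2's window and `1024(d+1)(d+4)L²α₀ ≤ 1`, every loop variable of every `V̄ʲ`, `j ≤ k`, is within `1∕8` of `1`); (T³ arithmetic) `window_loops`.
* §2 (the scalar field) `expUnit_I_real_mem_unitaryUnits`, `norm_expUnit_I_real_sub_one_le`, `pull_expUnit_I_real_eq_expCfg`, `pdev_pull_expUnit_I_real_le` (`≤ 4|t|Σ|r|`), `loopHolU_emlIterU_eq_dbarIterU`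
  (abelian loop variables are gauge invariant), ★`torusLoops_small`, `pdev_one_eq_zero`, `lt_three_mul_of_le_half`, `scalarData_of_small`, ★`zdLoops_small`, ★★`zdFrames_small`,
  ★★`scalarClauses_small` (the three clauses under one `δ`, in the letters of ✓`QTw_smulI_one_eq_QTw_one`'s `hδ` VERBATIM).
HONEST SCOPE.  Assembly by name over lit-balaban's kernel theorems (Props. 2, 7-admitted) and ★w8∕w5-20520's abelian torus tower; nothing of print is asserted; the crux is NOT advanced by this file.

References: T. Bałaban, CMP **98** (1985) 17–51 [Balaban1985Averaging] (Prop. 2 (52)–(54) p.26, p.25, (22)–(24) p.21, (97)+(99) p.32, Prop. 4 p.38, (159)–(163) p.42); CMP **99** (1985) 75–102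
[Balaban1985RegularSpaces] (Prop. 7 (1.139)–(1.145) p.100); CMP **95** (1984) 17–40 [Balaban1984PropagatorsI] ((1.18) p.20); CMP **109** (1987) 249–301 [Balaban1987RG1] ((0.4), (0.11) p.253).
-/

set_option autoImplicit false

noncomputable section

open scoped Matrix.Norms.L2Operator Topology

namespace Summit.QuantumFields.YangMills.Theorems.Prop7QTwCentralScalarField

open NormedSpace Filter
open Literature.MathematicalPhysics.QuantumFieldTheory.Balaban1983to89
open T4Continuum BlockAveraging ExpMeanLog MatrixLog
open T3ContinuumYM3Torus
open T3LevelShift (siteShift bondShift)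
open T3PrintedRegularOrbits (sites_eq)
open T3PrintedRegularMinimiser (RegPr)
open T3SectALandauChart (bgUnits bgUnits_one)
open B7Prop1Explicit renaming Site → LSite
open B7Prop1Explicit (e expUnit val_expUnit boxVec treeWord hol hol_cons hol_nil stepHol_true stepHol_false plaqWord Wcx U1 mem_U1 norm_inv_sub_one_le hol_mem)
open B7Prop2Explicit (avgIter pdev C0 c2' AvgClosed unitaryUnits unitaryUnits_le_U1 avgClosed_unitaryUnits le_pdev avgIter_mem prop2_explicit_lt_two norm_Wcx_sub_one_le mem_unitaryUnits)
open B7Prop3Flat (expCfg c3)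
open B7Eq92Concrete (tHol tHol_one_left tildIter tildIter_one_left avgIter_one vcov)
open B7Eq99Concrete (wrec wrec_eq_vcov)
open B8Ineq132 (plaqF)
open B8Ineq1144TwistedAxial (pdev_le_of_forall)
open B8Prop7AdmittedFamily (norm_vcov_sub_one_le norm_tHol_tildIter_sub_one_le)
open B8Lemma1NonAbelian (norm_units_mul_sub_one_le)
open B10Eq27TorusAxialLog (holT pull pull_apply transl gaugeActT)
open Summit.QuantumFields.YangMills.Theorems.Prop7SPrint (basePt)
open Summit.QuantumFields.YangMills.Theorems.Prop8Chart (loopHolU emlIterU loopHolU_gaugeActT)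
open Summit.QuantumFields.YangMills.Theorems.Prop8ChartDoubleBar (dbarIterU)
open Summit.QuantumFields.YangMills.Theorems.Prop7SymAvgTwSym (scalarTower_small_T3 dbarIterU_eq_gaugeActT_frameAccU_one)
open Summit.QuantumFields.YangMills.Theorems.Prop7FrameResponseCombSU2 (windows_of_ten7 tower_windows_of_ten7)

/-! ## §1 Generic `ℤᵈ`: loop variables of the averaged towers from Proposition 2 -/

section Generic

variable {d : ℕ} {𝔸 : Type*} [NormedRing 𝔸] [NormOneClass 𝔸] [NormedAlgebra ℂ 𝔸] [CompleteSpace 𝔸]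

omit [NormedAlgebra ℂ 𝔸] [CompleteSpace 𝔸] in
/-- **A PLAQUETTE VARIABLE IS WITHIN `4s` OF `1` IF ITS FOUR BOND VARIABLES ARE WITHIN `s`** (values in `{|u| ≤ 1, |u⁻¹| ≤ 1}`). [cite: Balaban1985Averaging, (44) p.24, (17) p.20] -/
theorem norm_plaq_sub_one_le_of_bonds {V : LSite d → Fin d → 𝔸ˣ} (hV : ∀ x κ, V x κ ∈ U1 𝔸) {s : ℝ} (hs : ∀ x κ, ‖((V x κ : 𝔸ˣ) : 𝔸) - 1‖ ≤ s)
    (x : LSite d) (κ ν : Fin d) : ‖plaqF V κ ν x - 1‖ ≤ 4 * s := by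
  unfold plaqF
  simp only [plaqWord, hol_cons, hol_nil, mul_one, stepHol_true, stepHol_false, B7Prop1Explicit.Letter.vec_true, B7Prop1Explicit.Letter.vec_false]
  have hi : ∀ x κ, ‖(((V x κ)⁻¹ : 𝔸ˣ) : 𝔸) - 1‖ ≤ s := fun x κ => (norm_inv_sub_one_le (hV x κ)).trans (hs x κ)
  have hiU : ∀ x κ, (V x κ)⁻¹ ∈ U1 𝔸 := fun x κ => (U1 𝔸).inv_mem (hV x κ)
  calc ‖((V x κ * (V (x + e κ) ν * ((V (x + e κ + e ν + -e κ) κ)⁻¹ * (V (x + e κ + e ν + -e κ + -e ν) ν)⁻¹)) : 𝔸ˣ) : 𝔸) - 1‖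
      ≤ ‖((V x κ : 𝔸ˣ) : 𝔸) - 1‖ + (‖((V (x + e κ) ν : 𝔸ˣ) : 𝔸) - 1‖ + (‖(((V (x + e κ + e ν + -e κ) κ)⁻¹ : 𝔸ˣ) : 𝔸) - 1‖ + ‖(((V (x + e κ + e ν + -e κ + -e ν) ν)⁻¹ : 𝔸ˣ) : 𝔸) - 1‖)) :=
        (norm_units_mul_sub_one_le (hV _ _)).trans (add_le_add le_rfl ((norm_units_mul_sub_one_le (hV _ _)).trans (add_le_add le_rfl (norm_units_mul_sub_one_le (hiU _ _)))))
    _ ≤ s + (s + (s + s)) := add_le_add (hs _ _) (add_le_add (hs _ _) (add_le_add (hi _ _) (hi _ _)))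
    _ = 4 * s := by ring

/-- ★ **THE LOOP VARIABLES (42) OF EVERY AVERAGED TOWER `V̄ʲ`, `j ≤ k`, ARE WITHIN `1∕8` OF `1`** for a `G`-valued `V` with `sup_p |V(∂p) − 1| < α₀L^{−2k}` in [Balaban1985Averaging] Prop. 2's
window (`C₀α₀ ≤ ⅓`, `2α₀ ≤ c₂′`) and `1024(d+1)(d+4)L²α₀ ≤ 1`: Prop. 2 (`avgIter_mem`, `prop2_explicit_lt_two`: `|V̄ʲ(∂p) − 1| < 2α₀` at every `j ≤ k` since `L^{−2k} ≤ L^{−2j}`) and p. 25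
(`norm_Wcx_sub_one_le`: `|V̄ʲ(Γ_{c,x})V̄ʲ(c)⁻¹ − 1| ≤ 16(d+1)(d+4)L²·2α₀`). [cite: Balaban1985Averaging, Prop. 2 (52)–(54) p.26, p.25 (displays before (47))] -/
theorem loops_le_eighth_of_pdev (L : ℕ) (hL : 2 ≤ L) {G : Subgroup 𝔸ˣ} (hG : AvgClosed d L G) (hGU : G ≤ U1 𝔸) (V : LSite d → Fin d → 𝔸ˣ) (hV : ∀ x κ, V x κ ∈ G)
    {α₀ : ℝ} (hα : 0 < α₀) (hα3 : C0 d * α₀ ≤ 1 / 3) (hα2 : 2 * α₀ ≤ c2' d L) (hwin : 1024 * ((d : ℝ) + 1) * ((d : ℝ) + 4) * (L : ℝ) ^ 2 * α₀ ≤ 1)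
    (k : ℕ) (h52 : pdev V < α₀ * (((L : ℝ) ^ k)⁻¹) ^ 2) :
    ∀ j, j ≤ k → ∀ (q : LSite d) (κ : Fin d) (r : Fin d → Fin L), ‖((Wcx L (avgIter L V j) q κ (boxVec L r) : 𝔸ˣ) : 𝔸) - 1‖ ≤ 1 / 8 := by
  intro j hj q κ r
  have hL1 : 1 ≤ L := le_trans (by norm_num) hL
  have hLr : (1 : ℝ) ≤ L := by exact_mod_cast hL1
  -- (52) at level `j`
  have h52j : pdev V < α₀ * (((L : ℝ) ^ j)⁻¹) ^ 2 := by
    refine h52.trans_le (mul_le_mul_of_nonneg_left ?_ hα.le)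
    have hjk : (L : ℝ) ^ j ≤ (L : ℝ) ^ k := pow_le_pow_right₀ hLr hj
    have hpos : 0 < (L : ℝ) ^ j := by positivity
    exact pow_le_pow_left₀ (by positivity) (inv_anti₀ hpos hjk) 2
  have hmem : ∀ x κ, avgIter L V j x κ ∈ U1 𝔸 := fun x κ => hGU (avgIter_mem L hL hG j V hV hα hα3 hα2 h52j j le_rfl x κ)
  have hp : pdev (avgIter L V j) < 2 * α₀ := prop2_explicit_lt_two L hL hG j V hV hα hα3 hα2 h52j
  have h44 : ∀ (x : LSite d) (κ κ' : Fin d), κ ≠ κ' → ‖((hol (avgIter L V j) x (plaqWord κ κ') : 𝔸ˣ) : 𝔸) - 1‖ ≤ 2 * α₀ :=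
    fun x κ κ' _ => (le_pdev hmem x κ κ').trans hp.le
  have hd0 : (0 : ℝ) ≤ d := Nat.cast_nonneg d
  have hsmall : 512 * ((d : ℝ) + 1) * ((d : ℝ) + 4) * (L : ℝ) ^ 2 * (2 * α₀) ≤ 1 := by nlinarith
  have hW := norm_Wcx_sub_one_le L hL1 (avgIter L V j) hmem (by positivity : (0 : ℝ) ≤ 2 * α₀) hsmall h44 q κ r
  refine hW.trans ?_
  nlinarith [sq_nonneg (L : ℝ)]

end Generic


/-! ### T³ arithmetic: the loop window at the member -/

section Window

variable (F : T3Family) {n K : ℕ}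

/-- the loop window at the member: `1024·(d+1)(d+4)·L²·(2ε₀) ≤ 1` and `·(3ε₀) ≤ 1` from `10⁷L³ε₀ ≤ 1` (`d = 3`, `L ≥ 3`). [cite: Balaban1985Averaging, Prop. 2 p.26] -/
theorem window_loops {ε₀ : ℝ} (hε₀ : 0 ≤ ε₀) (hε : 10 ^ 7 * (F.L : ℝ) ^ 3 * ε₀ ≤ 1) :
    1024 * (((F.P K).d : ℝ) + 1) * (((F.P K).d : ℝ) + 4) * ((F.P K).L : ℝ) ^ 2 * (2 * ε₀) ≤ 1 ∧
      1024 * (((F.P K).d : ℝ) + 1) * (((F.P K).d : ℝ) + 4) * ((F.P K).L : ℝ) ^ 2 * (3 * ε₀) ≤ 1 := by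
  have hL : (3 : ℝ) ≤ F.L := by
    have h3 : 3 ≤ F.L := by obtain ⟨a, ha⟩ := F.hL.1; have := F.hL.2; omega
    exact_mod_cast h3
  have hd : (F.P K).d = 3 := T3Family.P_d F K
  have hPL : (F.P K).L = F.L := rfl
  rw [hd, hPL]
  push_cast
  have hx : 0 ≤ (F.L : ℝ) ^ 2 * ε₀ := by positivity
  have hL2 : 3 * ((F.L : ℝ) ^ 2 * ε₀) ≤ (F.L : ℝ) ^ 3 * ε₀ := by
    have h1 := mul_le_mul_of_nonneg_right hL hx
    calc 3 * ((F.L : ℝ) ^ 2 * ε₀) ≤ (F.L : ℝ) * ((F.L : ℝ) ^ 2 * ε₀) := h1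
      _ = (F.L : ℝ) ^ 3 * ε₀ := by ring
  constructor <;> nlinarith

end Window

/-! ## §2 The unitary scalar field `e^{itr}` (`r` real, `t` real): its three clauses hold for small `|t|` -/

section Scalar

/-- `e^{is}` (`s` real) is a unitary unit of `ℂ`. [cite: Balaban1985Averaging, (22)-(24) p.21] -/
theorem expUnit_I_real_mem_unitaryUnits (s : ℝ) : expUnit (Complex.I * (s : ℂ)) ∈ unitaryUnits ℂ := by
  have hval : ((expUnit (Complex.I * (s : ℂ)) : ℂˣ) : ℂ) = Complex.exp (Complex.I * s) := by rw [val_expUnit, Complex.exp_eq_exp_ℂ]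
  have hconj : (starRingEnd ℂ) (Complex.exp (Complex.I * s)) = Complex.exp (-(Complex.I * s)) := by
    rw [← Complex.exp_conj, map_mul, Complex.conj_I, Complex.conj_ofReal, neg_mul]
  rw [mem_unitaryUnits, hval, Unitary.mem_iff, Complex.star_def, hconj, ← Complex.exp_add, ← Complex.exp_add, neg_add_cancel, add_neg_cancel, Complex.exp_zero]
  exact ⟨rfl, rfl⟩

/-- `|e^{is} − 1| ≤ |s|` (`s` real). [cite: Balaban1985Averaging, (24) p.21] -/
theorem norm_expUnit_I_real_sub_one_le (s : ℝ) : ‖((expUnit (Complex.I * (s : ℂ)) : ℂˣ) : ℂ) - 1‖ ≤ |s| := by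
  rw [val_expUnit, ← Complex.exp_eq_exp_ℂ, ← Real.norm_eq_abs]
  exact Real.norm_exp_I_mul_ofReal_sub_one_le

variable (F : T3Family) {n K : ℕ} (h : n ≤ K)

/-- the based pullback of the scalar field is lit's `expCfg` of the pulled-back exponent (`rfl`). [cite: Balaban1985RegularSpaces, (1.3) p.77; Balaban1985Averaging, (8) p.19] -/
theorem pull_expUnit_I_real_eq_expCfg (r : PBond (F.P K) 0 → ℝ) (t : ℝ) (x₀ : Site (F.P K) 0) :
    pull (fun b : PBond (F.P K) 0 => expUnit (Complex.I * (((t * r b : ℝ)) : ℂ))) x₀ =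
      expCfg (fun (z : LSite (F.P K).d) (κ : Fin (F.P K).d) => Complex.I * (((t * r ⟨transl x₀ z, κ⟩ : ℝ)) : ℂ)) := rfl

/-- **`sup_p |e^{itr}(∂p) − 1| ≤ 4|t|·Σ_b|r(b)|` ON THE BASED PULLBACK** (every bond variable is within `|t|·Σ|r|` of `1`; §1). [cite: Balaban1985Averaging, (44) p.24, (52) p.26] -/
theorem pdev_pull_expUnit_I_real_le (r : PBond (F.P K) 0 → ℝ) (t : ℝ) (x₀ : Site (F.P K) 0) :
    pdev (pull (fun b : PBond (F.P K) 0 => expUnit (Complex.I * (((t * r b : ℝ)) : ℂ))) x₀) ≤ 4 * (|t| * ∑ b, |r b|) := by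
  have hM : ∀ b, |r b| ≤ ∑ b, |r b| := fun b => Finset.single_le_sum (f := fun b => |r b|) (fun b _ => abs_nonneg (r b)) (Finset.mem_univ b)
  have hV : ∀ z κ, pull (fun b : PBond (F.P K) 0 => expUnit (Complex.I * (((t * r b : ℝ)) : ℂ))) x₀ z κ ∈ U1 ℂ := fun z κ => by
    rw [pull_apply]; exact unitaryUnits_le_U1 (expUnit_I_real_mem_unitaryUnits _)
  have hs : ∀ z κ, ‖((pull (fun b : PBond (F.P K) 0 => expUnit (Complex.I * (((t * r b : ℝ)) : ℂ))) x₀ z κ : ℂˣ) : ℂ) - 1‖ ≤ |t| * ∑ b, |r b| := fun z κ => by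
    rw [pull_apply]
    refine (norm_expUnit_I_real_sub_one_le _).trans ?_
    rw [abs_mul]
    exact mul_le_mul_of_nonneg_left (hM _) (abs_nonneg t)
  exact pdev_le_of_forall (by positivity) fun z κ ν _ => norm_plaq_sub_one_le_of_bonds hV hs z κ ν

/-- **ABELIAN LOOP VARIABLES ARE GAUGE INVARIANT**: at `𝔸 = ℂ` the (0.4) loop variables of the plain tower `Ūʲ(φ)` are those of the double-bar tower `U̿ʲ(φ) = (Ūʲφ)^{v⁻¹}`
(✓`dbarIterU_eq_gaugeActT_frameAccU_one`, ✓`loopHolU_gaugeActT`; the conjugation is trivial in a commutative group). [cite: Balaban1985Averaging, (97) p.32, (11) p.19; Balaban1987RG1, (0.4) p.253] -/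
theorem loopHolU_emlIterU_eq_dbarIterU {P : Params} (W : GaugeField P 0 ℂˣ) (j : ℕ) (c : PBond P (j + 1)) (i : Idx P) :
    loopHolU (emlIterU j W) c i = loopHolU (dbarIterU j W) c i := by
  rw [dbarIterU_eq_gaugeActT_frameAccU_one W j, loopHolU_gaugeActT, mul_inv_cancel_comm]

/-- **THE TORUS LOOP CLAUSE**: for `|t| < δ₁` every (0.4) loop variable of every level `j < K − n` of the plain torus tower of `e^{itr}` is within `1∕8` of `1` (✓`scalarTower_small_T3` for the
double-bar tower + gauge invariance of the abelian loops). [cite: Balaban1985Averaging, Prop. 4 (134)-(135) p.38; Balaban1984PropagatorsI, (1.18) p.20; Balaban1987RG1, (0.4) p.253] -/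
theorem torusLoops_small (r : PBond (F.P K) 0 → ℝ) :
    ∃ δ : ℝ, 0 < δ ∧ ∀ t : ℝ, |t| < δ → ∀ j, j < K - n → ∀ (c : PBond (F.P K) (j + 1)) (i : Idx (F.P K)),
      ‖((loopHolU (emlIterU j (fun b : PBond (F.P K) 0 => expUnit (Complex.I * (((t * r b : ℝ)) : ℂ)))) c i : ℂˣ) : ℂ) - 1‖ ≤ 1 / 8 := by
  obtain ⟨δ, hδ0, hδ⟩ := scalarTower_small_T3 F (n := n) (K := K) (fun b => Complex.I * (r b : ℂ))
  refine ⟨δ, hδ0, fun t ht j hj c i => ?_⟩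
  have hnt : ‖(t : ℂ)‖ < δ := by rwa [Complex.norm_real, Real.norm_eq_abs]
  obtain ⟨hloop, -⟩ := hδ (t : ℂ) hnt
  have hφ : (fun b : PBond (F.P K) 0 => expUnit (Complex.I * (((t * r b : ℝ)) : ℂ))) = fun b => expUnit ((t : ℂ) * (Complex.I * (r b : ℂ))) := by
    funext b; congr 1; push_cast; ring
  rw [loopHolU_emlIterU_eq_dbarIterU, hφ]
  exact hloop j hj c i

/-- the flat background of `ℤ³` has no plaquette deviation. [cite: Balaban1985Averaging, (44) p.24] -/
theorem pdev_one_eq_zero {d : ℕ} : pdev (1 : LSite d → Fin d → ℂˣ) = 0 := by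
  unfold pdev; simp [B8Ineq130.hol_one]

/-- pure arithmetic: `p ≤ e∕2`, `0 < e` ⇒ `p < 3e`. [folklore] -/
theorem lt_three_mul_of_le_half {p e : ℝ} (hp : p ≤ e / 2) (he : 0 < e) : p < 3 * e := by linarith

/-- **THE SCALAR DATA IN THE SMALL-`t` REGIME**: with `ε_s := (10⁷L³)⁻¹`, `k = K − n`, `b := (ε_s∕6)·L^{−k}`, if `|t|·Σ|r| ≤ ε_s·L^{−2k}∕8` then the pulled-back exponent `B = (itr)♯` has `sup|B| ≤ b` and the
scalar field `e^{B}` has `sup_p|e^{B}(∂p) − 1| < 3ε_s·L^{−2k}` (the (1.141)-type window of lit `B8Prop7AdmittedFamily` at `αP = 3ε_s`). [cite: Balaban1985RegularSpaces, (1.140)-(1.141) p.100; Balaban1985Averaging, (52) p.26] -/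
theorem scalarData_of_small (r : PBond (F.P K) 0 → ℝ) (t : ℝ)
    (ht : |t| * ∑ b, |r b| ≤ (10 ^ 7 * (F.L : ℝ) ^ 3)⁻¹ * ((((F.P K).L : ℝ) ^ (K - n))⁻¹) ^ 2 / 8) :
    (∀ (z : LSite (F.P K).d) (κ : Fin (F.P K).d), ‖Complex.I * (((t * r ⟨transl (basePt F n K) z, κ⟩ : ℝ)) : ℂ)‖ ≤ (10 ^ 7 * (F.L : ℝ) ^ 3)⁻¹ / 6 * (((F.P K).L : ℝ) ^ (K - n))⁻¹) ∧
      pdev (expCfg (fun (z : LSite (F.P K).d) (κ : Fin (F.P K).d) => Complex.I * (((t * r ⟨transl (basePt F n K) z, κ⟩ : ℝ)) : ℂ)))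
        < 3 * (10 ^ 7 * (F.L : ℝ) ^ 3)⁻¹ * ((((F.P K).L : ℝ) ^ (K - n))⁻¹) ^ 2 := by
  have hPL : (F.P K).L = F.L := rfl
  have hL3 : (3 : ℝ) ≤ F.L := by
    have h3 : 3 ≤ F.L := by obtain ⟨a, ha⟩ := F.hL.1; have := F.hL.2; omega
    exact_mod_cast h3
  have hpos7 : (0 : ℝ) < 10 ^ 7 * (F.L : ℝ) ^ 3 := by positivity
  have hεs0 : 0 < (10 ^ 7 * (F.L : ℝ) ^ 3)⁻¹ := inv_pos.2 hpos7
  have hLk : (0 : ℝ) < ((F.P K).L : ℝ) ^ (K - n) := by rw [hPL]; positivity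
  have hLk1 : (1 : ℝ) ≤ ((F.P K).L : ℝ) ^ (K - n) := by rw [hPL]; exact one_le_pow₀ (by linarith)
  have hLinv : ((((F.P K).L : ℝ) ^ (K - n))⁻¹) ^ 2 ≤ (((F.P K).L : ℝ) ^ (K - n))⁻¹ := by
    have h1 : (((F.P K).L : ℝ) ^ (K - n))⁻¹ ≤ 1 := inv_le_one_of_one_le₀ hLk1
    have h0 : 0 ≤ (((F.P K).L : ℝ) ^ (K - n))⁻¹ := inv_nonneg.2 hLk.le
    nlinarith
  have hrM : ∀ b, |r b| ≤ ∑ b, |r b| := fun b => Finset.single_le_sum (f := fun b => |r b|) (fun b _ => abs_nonneg (r b)) (Finset.mem_univ b)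
  refine ⟨fun z κ => ?_, ?_⟩
  · rw [norm_mul, Complex.norm_I, one_mul, Complex.norm_real, Real.norm_eq_abs, abs_mul]
    calc |t| * |r ⟨transl (basePt F n K) z, κ⟩| ≤ |t| * ∑ b, |r b| := mul_le_mul_of_nonneg_left (hrM _) (abs_nonneg t)
      _ ≤ (10 ^ 7 * (F.L : ℝ) ^ 3)⁻¹ * ((((F.P K).L : ℝ) ^ (K - n))⁻¹) ^ 2 / 8 := ht
      _ ≤ (10 ^ 7 * (F.L : ℝ) ^ 3)⁻¹ * (((F.P K).L : ℝ) ^ (K - n))⁻¹ / 8 := by gcongr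
      _ ≤ (10 ^ 7 * (F.L : ℝ) ^ 3)⁻¹ / 6 * (((F.P K).L : ℝ) ^ (K - n))⁻¹ := by nlinarith [inv_nonneg.2 hLk.le]
  · have hle := pdev_pull_expUnit_I_real_le F r t (basePt F n K)
    rw [pull_expUnit_I_real_eq_expCfg] at hle
    have hpos : 0 < (10 ^ 7 * (F.L : ℝ) ^ 3)⁻¹ * ((((F.P K).L : ℝ) ^ (K - n))⁻¹) ^ 2 := by positivity
    have h3 := lt_three_mul_of_le_half (hle.trans (by linarith)) hpos
    rwa [← mul_assoc] at h3

/-- ★ **THE `ℤ³` LOOP CLAUSE OF THE UNITARY SCALAR FIELD**: for `|t| < δ` every loop variable (42) of every `ℤ³` iterate `\overline{(e^{itr})♯}ʲ`, `j < K − n`, is within `1∕8` of `1`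
([Balaban1985Averaging] Prop. 2 at `𝔸 = ℂ`, `G = U(1)`, window `3ε_s`, `ε_s = (10⁷L³)⁻¹`; §1). [cite: Balaban1985Averaging, Prop. 2 (52)-(54) p.26, p.25] -/
theorem zdLoops_small (r : PBond (F.P K) 0 → ℝ) :
    ∃ δ : ℝ, 0 < δ ∧ ∀ t : ℝ, |t| < δ →
      ∀ j, j < K - n → ∀ (q : LSite (F.P K).d) (κ : Fin (F.P K).d) (rr : Fin (F.P K).d → Fin (F.P K).L),
        ‖((Wcx (F.P K).L (avgIter (F.P K).L (pull (fun b : PBond (F.P K) 0 => expUnit (Complex.I * (((t * r b : ℝ)) : ℂ))) (basePt F n K)) j) q κ (boxVec (F.P K).L rr) : ℂˣ) : ℂ) - 1‖ ≤ 1 / 8 := by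
  have hL2 : 2 ≤ (F.P K).L := (F.P K).hL.2
  have hL3 : (3 : ℝ) ≤ F.L := by
    have h3 : 3 ≤ F.L := by obtain ⟨a, ha⟩ := F.hL.1; have := F.hL.2; omega
    exact_mod_cast h3
  have hpos7 : (0 : ℝ) < 10 ^ 7 * (F.L : ℝ) ^ 3 := by positivity
  have hεs0 : 0 < (10 ^ 7 * (F.L : ℝ) ^ 3)⁻¹ := inv_pos.2 hpos7
  have hεs1 : 10 ^ 7 * (F.L : ℝ) ^ 3 * (10 ^ 7 * (F.L : ℝ) ^ 3)⁻¹ ≤ 1 := by rw [mul_inv_cancel₀ hpos7.ne']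
  obtain ⟨-, -, -, hαP3, hαP2⟩ := windows_of_ten7 F (K := K) hεs0.le hεs1
  obtain ⟨-, hwin3⟩ := window_loops F (K := K) hεs0.le hεs1
  have hM0 : 0 ≤ ∑ b, |r b| := Finset.sum_nonneg fun b _ => abs_nonneg (r b)
  have hLk : (0 : ℝ) < ((F.P K).L : ℝ) ^ (K - n) := pow_pos (by exact_mod_cast (F.P K).L_pos) _
  obtain ⟨δ, hδ⟩ : ∃ δ : ℝ, δ = (10 ^ 7 * (F.L : ℝ) ^ 3)⁻¹ * ((((F.P K).L : ℝ) ^ (K - n))⁻¹) ^ 2 / (8 * (∑ b, |r b| + 1)) := ⟨_, rfl⟩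
  have hδ0 : 0 < δ := by rw [hδ]; positivity
  refine ⟨δ, hδ0, fun t ht j hj q κ rr => ?_⟩
  have htM : |t| * ∑ b, |r b| ≤ (10 ^ 7 * (F.L : ℝ) ^ 3)⁻¹ * ((((F.P K).L : ℝ) ^ (K - n))⁻¹) ^ 2 / 8 := by
    have h1 : |t| * ∑ b, |r b| ≤ |t| * (∑ b, |r b| + 1) := mul_le_mul_of_nonneg_left (by linarith) (abs_nonneg t)
    have h2 : |t| * (∑ b, |r b| + 1) ≤ δ * (∑ b, |r b| + 1) := mul_le_mul_of_nonneg_right ht.le (by linarith)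
    have h3 : δ * (∑ b, |r b| + 1) = (10 ^ 7 * (F.L : ℝ) ^ 3)⁻¹ * ((((F.P K).L : ℝ) ^ (K - n))⁻¹) ^ 2 / 8 := by rw [hδ]; field_simp
    linarith
  obtain ⟨-, hP'⟩ := scalarData_of_small F (n := n) (K := K) r t htM
  have hBu : ∀ (z : LSite (F.P K).d) (κ : Fin (F.P K).d),
      expCfg (fun (z : LSite (F.P K).d) (κ : Fin (F.P K).d) => Complex.I * (((t * r ⟨transl (basePt F n K) z, κ⟩ : ℝ)) : ℂ)) z κ ∈ unitaryUnits ℂ :=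
    fun z κ => expUnit_I_real_mem_unitaryUnits _
  rw [pull_expUnit_I_real_eq_expCfg]
  exact loops_le_eighth_of_pdev (F.P K).L hL2 (avgClosed_unitaryUnits (F.P K).d (F.P K).L) unitaryUnits_le_U1 _ hBu (by positivity) hαP3 hαP2 hwin3 (K - n) hP' j hj.le q κ rr

/-- ★★ **THE FLAT FRAME QUOTIENTS OF THE UNITARY SCALAR FIELD**: for `|t| < δ` the quotients `v_j(Lw)⁻¹·\overline{φ♯}ʲ(Γ_{Lw,x})·v_j(x)`, `j < K − n`, `φ♯ = (e^{itr})♯`, `v_j = wrec L 1 φ♯ j`, are within `1`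
of `1` (lit `B8Prop7AdmittedFamily.norm_vcov_sub_one_le` (163) and `norm_tHol_tildIter_sub_one_le` (162) at `𝔸 = ℂ`, `U₀ = 1`, `U₁ = φ♯`, every window the FIXED number `ε_s = (10⁷L³)⁻¹` through
✓`windows_of_ten7`∕`tower_windows_of_ten7`). [cite: Balaban1985Averaging, (159)-(163) p.42, (97)+(99) p.32; Balaban1985RegularSpaces, Prop. 7 p.100] -/
theorem zdFrames_small (r : PBond (F.P K) 0 → ℝ) :
    ∃ δ : ℝ, 0 < δ ∧ ∀ t : ℝ, |t| < δ →
      ∀ j, j < K - n → ∀ (w : LSite (F.P K).d) (rr : Fin (F.P K).d → Fin (F.P K).L),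
        ‖((((wrec (F.P K).L 1 (pull (fun b : PBond (F.P K) 0 => expUnit (Complex.I * (((t * r b : ℝ)) : ℂ))) (basePt F n K)) j (((F.P K).L : ℤ) • w))⁻¹ *
            (hol (avgIter (F.P K).L (pull (fun b : PBond (F.P K) 0 => expUnit (Complex.I * (((t * r b : ℝ)) : ℂ))) (basePt F n K)) j) (((F.P K).L : ℤ) • w) (treeWord (boxVec (F.P K).L rr)) *
              wrec (F.P K).L 1 (pull (fun b : PBond (F.P K) 0 => expUnit (Complex.I * (((t * r b : ℝ)) : ℂ))) (basePt F n K)) j (((F.P K).L : ℤ) • w + boxVec (F.P K).L rr)) : ℂˣ)) : ℂ) - 1‖ < 1 := by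
  -- the fixed windows at `ε_s := (10⁷L³)⁻¹`
  have hL2 : 2 ≤ (F.P K).L := (F.P K).hL.2
  have hd3 : (F.P K).d = 3 := T3Family.P_d F K
  have hd1 : 1 ≤ (F.P K).d := by rw [hd3]; norm_num
  have hPL : (F.P K).L = F.L := rfl
  have hL3 : (3 : ℝ) ≤ F.L := by
    have h3 : 3 ≤ F.L := by obtain ⟨a, ha⟩ := F.hL.1; have := F.hL.2; omega
    exact_mod_cast h3
  have hpos7 : (0 : ℝ) < 10 ^ 7 * (F.L : ℝ) ^ 3 := by positivity
  have hεs0 : 0 < (10 ^ 7 * (F.L : ℝ) ^ 3)⁻¹ := inv_pos.2 hpos7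
  have hεs1 : 10 ^ 7 * (F.L : ℝ) ^ 3 * (10 ^ 7 * (F.L : ℝ) ^ 3)⁻¹ ≤ 1 := by rw [mul_inv_cancel₀ hpos7.ne']
  obtain ⟨hα3, hα4, -, hαP3, hαP2⟩ := windows_of_ten7 F (K := K) hεs0.le hεs1
  obtain ⟨hsmall, hc₃, hsm⟩ := tower_windows_of_ten7 F (K := K) hεs0.le hεs1
  have hLk : (0 : ℝ) < ((F.P K).L : ℝ) ^ (K - n) := by rw [hPL]; positivity
  have hM0 : 0 ≤ ∑ b, |r b| := Finset.sum_nonneg fun b _ => abs_nonneg (r b)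
  obtain ⟨δ, hδ⟩ : ∃ δ : ℝ, δ = (10 ^ 7 * (F.L : ℝ) ^ 3)⁻¹ * ((((F.P K).L : ℝ) ^ (K - n))⁻¹) ^ 2 / (8 * (∑ b, |r b| + 1)) := ⟨_, rfl⟩
  have hδ0 : 0 < δ := by rw [hδ]; positivity
  refine ⟨δ, hδ0, fun t ht j hj w rr => ?_⟩
  have htM : |t| * ∑ b, |r b| ≤ (10 ^ 7 * (F.L : ℝ) ^ 3)⁻¹ * ((((F.P K).L : ℝ) ^ (K - n))⁻¹) ^ 2 / 8 := by
    have h1 : |t| * ∑ b, |r b| ≤ |t| * (∑ b, |r b| + 1) := mul_le_mul_of_nonneg_left (by linarith) (abs_nonneg t)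
    have h2 : |t| * (∑ b, |r b| + 1) ≤ δ * (∑ b, |r b| + 1) := mul_le_mul_of_nonneg_right ht.le (by linarith)
    have h3 : δ * (∑ b, |r b| + 1) = (10 ^ 7 * (F.L : ℝ) ^ 3)⁻¹ * ((((F.P K).L : ℝ) ^ (K - n))⁻¹) ^ 2 / 8 := by rw [hδ]; field_simp
    linarith
  obtain ⟨hBb, hP'⟩ := scalarData_of_small F (n := n) (K := K) r t htM
  -- the letters of lit `B8Prop7AdmittedFamily` at `𝔸 = ℂ`, `U₀ = 1`, `B = (itr)♯`, `b = (ε_s∕6)L^{−k}`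
  obtain ⟨B, hB⟩ : ∃ B : LSite (F.P K).d → Fin (F.P K).d → ℂ, B = fun z κ => Complex.I * (((t * r ⟨transl (basePt F n K) z, κ⟩ : ℝ)) : ℂ) := ⟨_, rfl⟩
  have hφB : pull (fun b : PBond (F.P K) 0 => expUnit (Complex.I * (((t * r b : ℝ)) : ℂ))) (basePt F n K) = expCfg B := by rw [hB]; rfl
  obtain ⟨b, hb⟩ : ∃ b : ℝ, b = (10 ^ 7 * (F.L : ℝ) ^ 3)⁻¹ / 6 * (((F.P K).L : ℝ) ^ (K - n))⁻¹ := ⟨_, rfl⟩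
  have hb0 : 0 ≤ b := by rw [hb]; positivity
  have hLb : ((F.P K).L : ℝ) ^ (K - n) * b = (10 ^ 7 * (F.L : ℝ) ^ 3)⁻¹ / 6 := by rw [hb]; field_simp
  rw [← hB] at hP'
  have hBb' : ∀ (z : LSite (F.P K).d) (κ : Fin (F.P K).d), ‖B z κ‖ ≤ b := fun z κ => by rw [hB, hb]; exact hBb z κ
  clear hBb
  have hBb := hBb'
  have hU₀1 : ∀ (z : LSite (F.P K).d) (κ : Fin (F.P K).d), (1 : LSite (F.P K).d → Fin (F.P K).d → ℂˣ) z κ ∈ unitaryUnits ℂ := fun _ _ => (unitaryUnits ℂ).one_mem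
  have hBu : ∀ z κ, expCfg B z κ ∈ unitaryUnits ℂ := fun z κ => by rw [hB]; exact expUnit_I_real_mem_unitaryUnits _
  have hα : (0 : ℝ) < 2 * (10 ^ 7 * (F.L : ℝ) ^ 3)⁻¹ := by positivity
  have hαP : (0 : ℝ) < 3 * (10 ^ 7 * (F.L : ℝ) ^ 3)⁻¹ := by positivity
  have h52 : pdev (1 : LSite (F.P K).d → Fin (F.P K).d → ℂˣ) < 2 * (10 ^ 7 * (F.L : ℝ) ^ 3)⁻¹ * ((((F.P K).L : ℝ) ^ (K - n))⁻¹) ^ 2 := by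
    rw [pdev_one_eq_zero]; positivity
  have hP : pdev (expCfg B * (1 : LSite (F.P K).d → Fin (F.P K).d → ℂˣ)) < 3 * (10 ^ 7 * (F.L : ℝ) ^ 3)⁻¹ * ((((F.P K).L : ℝ) ^ (K - n))⁻¹) ^ 2 := by
    rw [mul_one]; exact hP'
  rw [← hLb] at hsmall hc₃ hsm
  rw [hφB, wrec_eq_vcov]
  have hjk : j ≤ K - n := hj.le
  -- the three factors are unitary, within `64dLʲb`, `128dLʲb + 4dL^{j+1}b`, `64dLʲb` of `1`
  obtain ⟨-, hvu⟩ := B8Prop7AdmittedFamily.dbavgCovIter_vcov_mem_unitaryUnits hd1 hL2 hU₀1 hBu hα hα3 hα4 h52 hb0 hBb hsmall hc₃ hsm hαP hαP3 hαP2 hP j hjk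
  have hv1 := norm_vcov_sub_one_le hL2 hU₀1 hα hα3 hα4 h52 hb0 hBb hsmall hc₃ hsm hjk (((F.P K).L : ℤ) • w)
  have hv2 := norm_vcov_sub_one_le hL2 hU₀1 hα hα3 hα4 h52 hb0 hBb hsmall hc₃ hsm hjk (((F.P K).L : ℤ) • w + boxVec (F.P K).L rr)
  have hT := norm_tHol_tildIter_sub_one_le hd1 hL2 hU₀1 hBu hα hα3 hα4 h52 hb0 hBb hsmall hc₃ hsm hαP hαP3 hαP2 hP hj w rr
  rw [avgIter_one, tildIter_one_left, tHol_one_left] at hT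
  have havgu : ∀ x κ, avgIter (F.P K).L (expCfg B) j x κ ∈ unitaryUnits ℂ := by
    have h := B8Prop7AdmittedFamily.avgIter_mul_mem_unitaryUnits hL2 hU₀1 hBu hαP hαP3 hαP2 hP j hjk
    rw [mul_one] at h
    exact h
  have hholU : hol (avgIter (F.P K).L (expCfg B) j) (((F.P K).L : ℤ) • w) (treeWord (boxVec (F.P K).L rr)) ∈ U1 ℂ :=
    hol_mem (fun x κ => unitaryUnits_le_U1 (havgu x κ)) _ _
  have hinvU : (vcov (F.P K).L 1 (expCfg B) j (((F.P K).L : ℤ) • w))⁻¹ ∈ U1 ℂ := unitaryUnits_le_U1 ((unitaryUnits ℂ).inv_mem (hvu _))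
  have hsum := (norm_units_mul_sub_one_le (q := hol (avgIter (F.P K).L (expCfg B) j) (((F.P K).L : ℤ) • w) (treeWord (boxVec (F.P K).L rr)) *
      vcov (F.P K).L 1 (expCfg B) j (((F.P K).L : ℤ) • w + boxVec (F.P K).L rr)) hinvU).trans
    (add_le_add hv1.2 ((norm_units_mul_sub_one_le (q := vcov (F.P K).L 1 (expCfg B) j (((F.P K).L : ℤ) • w + boxVec (F.P K).L rr)) hholU).trans (add_le_add hT hv2.1)))
  refine hsum.trans_lt ?_
  -- `64dLʲb + (128dLʲb + 4dL^{j+1}b + 64dLʲb) < 1` from `2048·d·Lᵏb ≤ 1`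
  have hd0 : (0 : ℝ) ≤ (F.P K).d := Nat.cast_nonneg _
  have hLr1 : (1 : ℝ) ≤ (F.P K).L := by rw [hPL]; linarith
  have hj1 : ((F.P K).L : ℝ) ^ j * b ≤ ((F.P K).L : ℝ) ^ (K - n) * b := mul_le_mul_of_nonneg_right (pow_le_pow_right₀ hLr1 hjk) hb0
  have hj2 : ((F.P K).L : ℝ) ^ (j + 1) * b ≤ ((F.P K).L : ℝ) ^ (K - n) * b := mul_le_mul_of_nonneg_right (pow_le_pow_right₀ hLr1 hj) hb0
  have hA : ((F.P K).d : ℝ) * (((F.P K).L : ℝ) ^ j * b) ≤ ((F.P K).d : ℝ) * (((F.P K).L : ℝ) ^ (K - n) * b) := mul_le_mul_of_nonneg_left hj1 hd0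
  have hB' : ((F.P K).d : ℝ) * (((F.P K).L : ℝ) ^ (j + 1) * b) ≤ ((F.P K).d : ℝ) * (((F.P K).L : ℝ) ^ (K - n) * b) := mul_le_mul_of_nonneg_left hj2 hd0
  have hC : 2048 * (((F.P K).d : ℝ) * (((F.P K).L : ℝ) ^ (K - n) * b)) ≤ 1 := by rw [← mul_assoc]; exact hsm
  have hX0 : 0 ≤ ((F.P K).d : ℝ) * (((F.P K).L : ℝ) ^ j * b) := mul_nonneg hd0 (mul_nonneg (pow_nonneg (le_trans zero_le_one hLr1) j) hb0)
  have key : 64 * (((F.P K).d : ℝ) * (((F.P K).L : ℝ) ^ j * b)) + (128 * (((F.P K).d : ℝ) * (((F.P K).L : ℝ) ^ j * b)) + 4 * (((F.P K).d : ℝ) * (((F.P K).L : ℝ) ^ (j + 1) * b))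
      + 64 * (((F.P K).d : ℝ) * (((F.P K).L : ℝ) ^ j * b))) < 1 := by linarith
  calc 64 * ((F.P K).d : ℝ) * (((F.P K).L : ℝ) ^ j * b) + (128 * ((F.P K).d : ℝ) * (((F.P K).L : ℝ) ^ j * b) + 4 * ((F.P K).d : ℝ) * (((F.P K).L : ℝ) ^ (j + 1) * b)
        + 64 * ((F.P K).d : ℝ) * (((F.P K).L : ℝ) ^ j * b))
      = 64 * (((F.P K).d : ℝ) * (((F.P K).L : ℝ) ^ j * b)) + (128 * (((F.P K).d : ℝ) * (((F.P K).L : ℝ) ^ j * b)) + 4 * (((F.P K).d : ℝ) * (((F.P K).L : ℝ) ^ (j + 1) * b))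
        + 64 * (((F.P K).d : ℝ) * (((F.P K).L : ℝ) ^ j * b))) := by ring
    _ < 1 := key

/-- ★★ **THE `∃ δ` CLAUSE OF ✓`QTw_smulI_one_eq_QTw_one`, DISCHARGED**: for `|t| < δ(r)` the unitary scalar field `e^{itr}` has `1∕8`-small loop variables at every level `< K − n` on `ℤ³` and on
the torus and flat frame quotients within `1`. [cite: Balaban1985Averaging, Prop. 2 p.26, Prop. 4 p.38, (159)-(163) p.42; Balaban1985RegularSpaces, Prop. 7 p.100] -/
theorem scalarClauses_small (r : PBond (F.P K) 0 → ℝ) :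
    ∃ δ : ℝ, 0 < δ ∧ ∀ t : ℝ, |t| < δ →
      (∀ j, j < K - n → ∀ (q : LSite (F.P K).d) (κ : Fin (F.P K).d) (rr : Fin (F.P K).d → Fin (F.P K).L),
        ‖((Wcx (F.P K).L (avgIter (F.P K).L (pull (fun b : PBond (F.P K) 0 => expUnit (Complex.I * (((t * r b : ℝ)) : ℂ))) (basePt F n K)) j) q κ (boxVec (F.P K).L rr) : ℂˣ) : ℂ) - 1‖ ≤ 1 / 8) ∧
      (∀ j, j < K - n → ∀ (w : LSite (F.P K).d) (rr : Fin (F.P K).d → Fin (F.P K).L),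
        ‖((((wrec (F.P K).L 1 (pull (fun b : PBond (F.P K) 0 => expUnit (Complex.I * (((t * r b : ℝ)) : ℂ))) (basePt F n K)) j (((F.P K).L : ℤ) • w))⁻¹ *
            (hol (avgIter (F.P K).L (pull (fun b : PBond (F.P K) 0 => expUnit (Complex.I * (((t * r b : ℝ)) : ℂ))) (basePt F n K)) j) (((F.P K).L : ℤ) • w) (treeWord (boxVec (F.P K).L rr)) *
              wrec (F.P K).L 1 (pull (fun b : PBond (F.P K) 0 => expUnit (Complex.I * (((t * r b : ℝ)) : ℂ))) (basePt F n K)) j (((F.P K).L : ℤ) • w + boxVec (F.P K).L rr)) : ℂˣ)) : ℂ) - 1‖ < 1) ∧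
      (∀ j, j < K - n → ∀ (c : PBond (F.P K) (j + 1)) (i : Idx (F.P K)),
        ‖((loopHolU (emlIterU j (fun b : PBond (F.P K) 0 => expUnit (Complex.I * (((t * r b : ℝ)) : ℂ)))) c i : ℂˣ) : ℂ) - 1‖ ≤ 1 / 8) := by
  obtain ⟨δ₁, hδ₁, h₁⟩ := torusLoops_small F (n := n) (K := K) r
  obtain ⟨δ₂, hδ₂, h₂⟩ := zdLoops_small F (n := n) (K := K) r
  obtain ⟨δ₃, hδ₃, h₃⟩ := zdFrames_small F (n := n) (K := K) r
  refine ⟨min δ₁ (min δ₂ δ₃), lt_min hδ₁ (lt_min hδ₂ hδ₃), fun t ht => ?_⟩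
  have ht₁ : |t| < δ₁ := ht.trans_le (min_le_left _ _)
  have ht₂ : |t| < δ₂ := (ht.trans_le (min_le_right _ _)).trans_le (min_le_left _ _)
  have ht₃ : |t| < δ₃ := (ht.trans_le (min_le_right _ _)).trans_le (min_le_right _ _)
  exact ⟨h₂ t ht₂, h₃ t ht₃, h₁ t ht₁⟩

end Scalar

end Summit.QuantumFields.YangMills.Theorems.Prop7QTwCentralScalarField

end
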